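import Literature.Computability.Complexity.MonotoneSwitchingChains
import Mathlib.Data.Real.Basic
import Mathlib.Tactic.Linarith
import Mathlib.Tactic.NormNum
import Mathlib.Tactic.SplitIfs
import Mathlib.Tactic.Push
import HarnessLib

/-!
# The two-sided approximation for monotone REAL circuits, with local pairs at the leaves (Jukna 2012, Thm 9.21)

Jukna 2012, Theorem 9.21 (Criterion for Real Circuits; proof due to A. Wigderson): the CNF/DNF
approximation method of Theorem 9.17 runs through circuits whose gates are arbitrary MONOTONE
REAL-VALUED functions of bounded fan-in, at the price of slightly larger correcting families. Every
real-valued wire `f` is approximated through all its thresholds `[f ≥ a]` at once, using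
`[φ(g₁,…,g_k) ≥ a] = ⋁_{φ(b) ≥ a} ⋀ᵢ [gᵢ ≥ bᵢ]` (monotonicity of `φ`), and the errors of ONE gate over
ALL thresholds are corrected by ONE exact family, because the representing DNFs are nested in `a`
(`MonotoneSwitchingChains.lean`).

This file proves the theorem in the LEAF-PAIR form of `MonotoneSwitchingLeafPairs.lean` (the form
consumed by gate-by-gate "sandwich" arguments): the program is a monotone real straight-line program
`ev : (Fin n → Bool) → Fin T → ℝ` over `n` Boolean leaves (wire `t` is a monotone function of arity
`≤ K` of leaves, read as `0/1` reals, and of earlier wires), leaf `j` carries a local pair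
`Cl j ⊒ Dl j` and is read through two valuations `cv`/`dv`; the conclusion gives global correcting
families `Cf` (exact `s`-clauses, `≤ T·(K(r-1))^s`) and `Df` (exact `r`-monomials, `≤ T·(s-1)^r`)
and, for every wire `t` and every real level `a`, a local pair `cnf ⊒ dnf` with
`Cf ∧ cnf ≤ [ev (cv x) t ≥ a]` and `[ev (dv x) t ≥ a] ≤ dnf ∨ Df`:

* `exists_prodDNF` — the product (conjunction) of finitely many DNFs as one DNF;
* `realProgram_exists_pairApproximators` — Theorem 9.21 in leaf-pair form.

## References

* S. Jukna, *Boolean Function Complexity: Advances and Frontiers*, Springer (2012), §9.6,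
  Theorem 9.21 and its proof (pp. 277–280) [Jukna2012].
* P. Pudlák, Lower bounds for resolution and cutting plane proofs and monotone computations,
  J. Symb. Logic 62(3) (1997) 981–998 (first lower bounds for monotone real circuits).
-/

namespace Literature.Computability.Complexity

open Finset

variable {ι : Type*} [Fintype ι] [DecidableEq ι]

omit [Fintype ι] in
/-- **Product of DNFs**: for every `k` there is an operation sending a `k`-tuple of DNFs `F i` to
one DNF that holds iff all `F i` hold, whose monomials are unions `⋃ᵢ f i` of one monomial
`f i ∈ F i` from each factor (so of width `≤ ∑ᵢ width(F i)`). [folklore] -/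
theorem exists_prodDNF (k : ℕ) :
    ∃ prodF : (Fin k → Finset (Finset ι)) → Finset (Finset ι), ∀ F : Fin k → Finset (Finset ι),
      (∀ x : ι → Bool, EvalDNF (prodF F) x ↔ ∀ i, EvalDNF (F i) x) ∧
      (∀ R ∈ prodF F, ∃ f : Fin k → Finset ι, (∀ i, f i ∈ F i) ∧ R = univ.biUnion f) := by
  classical
  refine ⟨fun F => ((univ : Finset (Fin k)).pi fun i => F i).image
      fun f => univ.attach.biUnion fun i => f i.1 i.2, fun F => ⟨fun x => ⟨?_, ?_⟩, ?_⟩⟩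
  · rintro ⟨R, hR, hRx⟩
    obtain ⟨f, hf, rfl⟩ := mem_image.1 hR
    intro i
    refine ⟨f i (mem_univ i), (mem_pi.1 hf) i (mem_univ i), fun e he => hRx e ?_⟩
    exact mem_biUnion.2 ⟨⟨i, mem_univ i⟩, mem_attach _ _, he⟩
  · intro h
    choose g hg hgx using h
    refine ⟨univ.attach.biUnion fun i => g i.1, mem_image.2 ⟨fun i _ => g i, mem_pi.2 fun i _ => hg i,
      rfl⟩, fun e he => ?_⟩
    obtain ⟨i, -, hei⟩ := mem_biUnion.1 he
    exact hgx i.1 e hei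
  · intro R hR
    obtain ⟨f, hf, rfl⟩ := mem_image.1 hR
    refine ⟨fun i => f i (mem_univ i), fun i => (mem_pi.1 hf) i (mem_univ i), ?_⟩
    ext e
    simp only [mem_biUnion, mem_attach, true_and, Subtype.exists, mem_univ, exists_true_left]

/-- **Theorem 9.21 of Jukna 2012 (criterion for monotone real circuits), leaf-pair form.** Along a
monotone real straight-line program `ev` of length `T` and fan-in `≤ K` over `n` Boolean leaves —
wire `t` is `φ_t` (monotone `ℝᵏ → ℝ`, `k ≤ K`) of leaves (as `0/1` reals) and of earlier wires —
whose leaf `j` carries the local pair `Cl j ⊒ Dl j` (an `(s-1)`-CNF above an `(r-1)`-DNF) read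
through `cv` (leaf `j` on whenever `Cl j` holds) and `dv` (leaf `j` on only if `Dl j` holds), there
are global correcting families `Cf` (exact `s`-clauses, `#Cf ≤ T (K(r-1))^s`) and `Df` (exact
`r`-monomials, `#Df ≤ T (s-1)^r`) such that EVERY threshold `[ev · t ≥ a]` of every wire has a pair
`cnf ⊒ dnf` of the same widths with `Cf ∧ cnf ≤ [ev (cv x) t ≥ a]` and
`[ev (dv x) t ≥ a] ≤ dnf ∨ Df`. (Per gate: the nested DNFs `E_a = ⋃_{b realised, φ(b) ≥ a} ∏ᵢ dnfᵢ^{bᵢ}`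
are switched to `(s-1)`-CNFs with one correcting family, `chainSwitching_dnf`, and those back to
`(r-1)`-DNFs with one more, `chainSwitching_cnf`.) [cite: Jukna2012, Thm. 9.21] -/
theorem realProgram_exists_pairApproximators {n r s T K : ℕ} (Dl Cl : Fin n → Finset (Finset ι))
    (cv dv : (ι → Bool) → Fin n → Bool)
    (hDl : ∀ j, ∀ R ∈ Dl j, #R ≤ r - 1) (hCl : ∀ j, ∀ S ∈ Cl j, #S ≤ s - 1)
    (hle : ∀ j x, EvalDNF (Dl j) x → EvalCNF (Cl j) x)
    (hcv : ∀ j x, EvalCNF (Cl j) x → cv x j = true)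
    (hdv : ∀ j x, dv x j = true → EvalDNF (Dl j) x)
    (ev : (Fin n → Bool) → Fin T → ℝ)
    (hprog : ∀ t : Fin T, ∃ (k : ℕ) (src : Fin k → Fin n ⊕ Fin T) (φ : (Fin k → ℝ) → ℝ), k ≤ K ∧
      (∀ i t', src i = Sum.inr t' → t' < t) ∧ Monotone φ ∧
      ∀ u : Fin n → Bool, ev u t =
        φ (fun i => Sum.elim (fun j => if u j then (1 : ℝ) else 0) (ev u) (src i))) :
    ∃ Cf Df : Finset (Finset ι), (∀ P ∈ Cf, #P = s) ∧ (∀ P ∈ Df, #P = r) ∧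
      #Cf ≤ T * (K * (r - 1)) ^ s ∧ #Df ≤ T * (s - 1) ^ r ∧
      ∀ (t : Fin T) (a : ℝ), ∃ dnf cnf : Finset (Finset ι),
        (∀ R ∈ dnf, #R ≤ r - 1) ∧ (∀ S ∈ cnf, #S ≤ s - 1) ∧
        (∀ x, EvalDNF dnf x → EvalCNF cnf x) ∧
        (∀ x, EvalCNF Cf x → EvalCNF cnf x → a ≤ ev (cv x) t) ∧
        (∀ x, a ≤ ev (dv x) t → EvalDNF dnf x ∨ EvalDNF Df x) := by
  classical
  -- Invariant along prefixes of the program, with TOTAL level-indexed pair functions.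
  suffices H : ∀ m : ℕ, m ≤ T →
      ∃ (dO cO : Fin T → ℝ → Finset (Finset ι)) (Cf Df : Finset (Finset ι)),
        (∀ P ∈ Cf, #P = s) ∧ (∀ P ∈ Df, #P = r) ∧
        #Cf ≤ m * (K * (r - 1)) ^ s ∧ #Df ≤ m * (s - 1) ^ r ∧
        ∀ t : Fin T, t.1 < m → ∀ a : ℝ,
          (∀ R ∈ dO t a, #R ≤ r - 1) ∧ (∀ S ∈ cO t a, #S ≤ s - 1) ∧
          (∀ x, EvalDNF (dO t a) x → EvalCNF (cO t a) x) ∧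
          (∀ x, EvalCNF Cf x → EvalCNF (cO t a) x → a ≤ ev (cv x) t) ∧
          (∀ x, a ≤ ev (dv x) t → EvalDNF (dO t a) x ∨ EvalDNF Df x) by
    obtain ⟨dO, cO, Cf, Df, hCf, hDf, hcC, hcD, hgood⟩ := H T le_rfl
    exact ⟨Cf, Df, hCf, hDf, hcC, hcD, fun t a => ⟨dO t a, cO t a, hgood t t.2 a⟩⟩
  intro m
  induction m with
  | zero =>
    intro _
    exact ⟨fun _ _ => ∅, fun _ _ => ∅, ∅, ∅, by simp, by simp, by simp, by simp,
      fun t ht => absurd ht (Nat.not_lt_zero _)⟩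
  | succ m ih =>
    intro hmT
    obtain ⟨dO, cO, Cf, Df, hCf, hDf, hcC, hcD, hgood⟩ := ih (Nat.le_of_succ_le hmT)
    -- the new wire
    set t₀ : Fin T := ⟨m, hmT⟩ with ht₀
    obtain ⟨k, src, φ, hk, hsrc, hmono, hev⟩ := hprog t₀
    -- values and level-indexed pairs of the arguments of the new gate
    let val : Fin k → (Fin n → Bool) → ℝ := fun i u =>
      Sum.elim (fun j => if u j then (1 : ℝ) else 0) (ev u) (src i)
    let dC : Fin k → ℝ → Finset (Finset ι) := fun i b =>
      Sum.elim (fun j => if b ≤ 0 then {∅} else if b ≤ 1 then Dl j else ∅) (fun t' => dO t' b) (src i)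
    let cC : Fin k → ℝ → Finset (Finset ι) := fun i b =>
      Sum.elim (fun j => if b ≤ 0 then ∅ else if b ≤ 1 then Cl j else {∅}) (fun t' => cO t' b) (src i)
    have hval : ∀ u, ev u t₀ = φ (fun i => val i u) := hev
    -- the four properties of the argument pairs
    have hP : ∀ (i : Fin k) (b : ℝ),
        (∀ R ∈ dC i b, #R ≤ r - 1) ∧ (∀ S ∈ cC i b, #S ≤ s - 1) ∧
        (∀ x, EvalDNF (dC i b) x → EvalCNF (cC i b) x) ∧
        (∀ x, EvalCNF Cf x → EvalCNF (cC i b) x → b ≤ val i (cv x)) ∧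
        (∀ x, b ≤ val i (dv x) → EvalDNF (dC i b) x ∨ EvalDNF Df x) := by
      intro i b
      simp only [val, dC, cC]
      cases hsi : src i with
      | inr t' =>
        simp only [Sum.elim_inr]
        exact hgood t' (hsrc i t' hsi) b
      | inl j =>
        simp only [Sum.elim_inl]
        by_cases hb0 : b ≤ 0
        · simp only [hb0, if_true]
          refine ⟨by simp, by simp, fun x _ S hS => absurd hS (by simp), fun x _ _ => ?_,
            fun x _ => Or.inl evalDNF_singleton_empty⟩
          split_ifs <;> linarith
        · by_cases hb1 : b ≤ 1
          · simp only [hb0, hb1, if_false, if_true]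
            refine ⟨hDl j, hCl j, hle j, fun x _ hx => ?_, fun x hx => Or.inl (hdv j x ?_)⟩
            · rw [hcv j x hx]; simpa using hb1
            · by_contra hne
              rw [Bool.not_eq_true] at hne
              rw [hne] at hx
              simp only [Bool.false_eq_true, if_false] at hx
              linarith
          · simp only [hb0, hb1, if_false]
            refine ⟨by simp, by simp, fun x hx => absurd hx (by simp [EvalDNF]), fun x _ hx =>
              absurd hx not_evalCNF_singleton_empty, fun x hx => ?_⟩
            exfalso
            push Not at hb1
            split_ifs at hx <;> linarith
    -- the product-of-DNFs operation on `k` factors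
    obtain ⟨prodF, hprodF⟩ := exists_prodDNF (ι := ι) k
    -- nested exact DNFs for the thresholds of the new wire (over the `dv`-realised argument values)
    let E : ℝ → Finset (Finset ι) := fun a =>
      ((univ : Finset (ι → Bool)).filter fun x' => a ≤ ev (dv x') t₀).biUnion
        fun x' => prodF fun i => dC i (val i (dv x'))
    have hEanti : ∀ a a' : ℝ, a ≤ a' → E a' ⊆ E a := by
      intro a a' haa'
      refine biUnion_subset_biUnion_of_subset_left _ fun x' hx' => ?_
      rw [mem_filter] at hx' ⊢
      exact ⟨hx'.1, haa'.trans hx'.2⟩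
    have hEchain : ∀ a a' : ℝ, E a ⊆ E a' ∨ E a' ⊆ E a := fun a a' =>
      (le_total a a').elim (fun h => Or.inr (hEanti _ _ h)) fun h => Or.inl (hEanti _ _ h)
    have hEw : ∀ a : ℝ, ∀ R ∈ E a, #R ≤ K * (r - 1) := by
      intro a R hR
      obtain ⟨x', -, hR⟩ := mem_biUnion.1 hR
      obtain ⟨f, hf, rfl⟩ := (hprodF _).2 R hR
      calc #(univ.biUnion f) ≤ ∑ i, #(f i) := card_biUnion_le
        _ ≤ ∑ _i : Fin k, (r - 1) := sum_le_sum fun i _ => (hP i _).1 _ (hf i)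
        _ = k * (r - 1) := by simp
        _ ≤ K * (r - 1) := Nat.mul_le_mul_right _ hk
    -- first switching (left approximators, one correcting family for all levels)
    obtain ⟨cnfN, C', hcnfNw, hC'w, hC'card, hcnfNanti, hEle, hcnfNcorr⟩ :=
      chainSwitching_dnf E hEchain (K * (r - 1)) s hEw
    -- second switching (right approximators, one more correcting family)
    have hcnfNchain : ∀ a a' : ℝ, cnfN a ⊆ cnfN a' ∨ cnfN a' ⊆ cnfN a := fun a a' =>
      (le_total a a').elim (fun h => Or.inl (hcnfNanti _ _ (hEanti _ _ h))) fun h =>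
        Or.inr (hcnfNanti _ _ (hEanti _ _ h))
    obtain ⟨dnfN, D', hdnfNw, hD'w, hD'card, hdnfNle, hcnfNcov⟩ :=
      chainSwitching_cnf cnfN hcnfNchain (s - 1) r hcnfNw
    -- two consequences of the product structure
    have hEup : ∀ (a : ℝ) (x : ι → Bool), a ≤ ev (dv x) t₀ →
        (∀ i, EvalDNF (dC i (val i (dv x))) x) → EvalDNF (E a) x := by
      intro a x hx hall
      obtain ⟨R, hR, hRx⟩ := ((hprodF _).1 x).2 hall
      exact ⟨R, mem_biUnion.2 ⟨x, mem_filter.2 ⟨mem_univ _, hx⟩, hR⟩, hRx⟩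
    have hElow : ∀ (a : ℝ) (x : ι → Bool), EvalCNF Cf x → EvalDNF (E a) x → a ≤ ev (cv x) t₀ := by
      intro a x hC hE
      obtain ⟨R, hR, hRx⟩ := hE
      obtain ⟨x', hx', hRmem⟩ := mem_biUnion.1 hR
      have hall : ∀ i, EvalDNF (dC i (val i (dv x'))) x := ((hprodF _).1 x).1 ⟨R, hRmem, hRx⟩
      have hle' : (fun i => val i (dv x')) ≤ fun i => val i (cv x) := fun i =>
        (hP i _).2.2.2.1 x hC ((hP i _).2.2.1 x (hall i))
      calc a ≤ ev (dv x') t₀ := (mem_filter.1 hx').2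
        _ = φ (fun i => val i (dv x')) := hval _
        _ ≤ φ (fun i => val i (cv x)) := hmono hle'
        _ = ev (cv x) t₀ := (hval _).symm
    -- the new data
    refine ⟨fun t a => if t = t₀ then dnfN a else dO t a,
      fun t a => if t = t₀ then cnfN a else cO t a, Cf ∪ C', Df ∪ D', ?_, ?_, ?_, ?_, ?_⟩
    · intro P hP
      rcases mem_union.1 hP with h | h
      · exact hCf P h
      · exact hC'w P h
    · intro P hP
      rcases mem_union.1 hP with h | h
      · exact hDf P h
      · exact hD'w P h
    · calc #(Cf ∪ C') ≤ #Cf + #C' := card_union_le _ _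
        _ ≤ m * (K * (r - 1)) ^ s + (K * (r - 1)) ^ s := add_le_add hcC hC'card
        _ = (m + 1) * (K * (r - 1)) ^ s := by ring
    · calc #(Df ∪ D') ≤ #Df + #D' := card_union_le _ _
        _ ≤ m * (s - 1) ^ r + (s - 1) ^ r := add_le_add hcD hD'card
        _ = (m + 1) * (s - 1) ^ r := by ring
    · intro t ht a
      by_cases htt : t = t₀
      · subst htt
        simp only [if_true]
        refine ⟨hdnfNw a, hcnfNw a, hdnfNle a, fun x hC hcn => ?_, fun x hx => ?_⟩
        · exact hElow a x (hC.anti subset_union_left)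
            (hcnfNcorr a x hcn (hC.anti subset_union_right))
        · by_cases hDfx : EvalDNF Df x
          · exact Or.inr (hDfx.mono subset_union_left)
          · have hall : ∀ i, EvalDNF (dC i (val i (dv x))) x := fun i =>
              ((hP i _).2.2.2.2 x le_rfl).resolve_right hDfx
            rcases hcnfNcov a x (hEle a x (hEup a x hx hall)) with h | h
            · exact Or.inl h
            · exact Or.inr (h.mono subset_union_right)
      · have hlt : t.1 < m := by
          have : t.1 ≠ m := fun h => htt (Fin.ext h)
          omega
        obtain ⟨h1, h2, h3, h4, h5⟩ := hgood t hlt a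
        simp only [htt, if_false]
        exact ⟨h1, h2, h3, fun x hC hc => h4 x (hC.anti subset_union_left) hc,
          fun x hx => (h5 x hx).imp_right fun h => h.mono subset_union_left⟩
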